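import Literature.MathematicalPhysics.QuantumFieldTheory.Balaban1983to89.B1Eq324BenfattoAppendixDWick
import Literature.MathematicalPhysics.QuantumFieldTheory.Balaban1983to89.B1Eq324BenfattoKernelRegression
import HarnessLib

/-!
# `Balaban1983to89.B1Eq324BenfattoKernelAppendixD` — [BenfattoEtAl1978] Appendix D p. 166, point ii) FOR A GENERAL COVARIANCE
# KERNEL: the diagram moments and the exponential clustering of the joint truncated expectations of monomial clusters under a
# SHIFTED Gaussian kernel field `𝒩(0,K)∘(u + ·)⁻¹` on any index set, and under the conditioned field `P̄^K_{C,z̄}` of a general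
# kernel on the lattice, PROVED

statement-level skeleton of published theorems with citation tags; proofs where landed; nothing here is a claim about the
Yang–Mills mass gap

WHY THIS MODULE (cell `pub-ymgap`, seat `dag-n08-c` gen 23; node N08 [Balaban1985UV3]; the [BenfattoEtAl1978] source chain behind
the (α)-row `h324`).  The KERNEL CENSUS of the tree's proof of the Basic Lemma (`…Sect5BasicLemma.basicLemmaPrinted_holds`,
seat note `N08-BASICLEMMA-KERNEL-CENSUS.md` §2) lists the 28 LIBRARY-INTERFACE theorems through which the §5 road reads the free
field (1.1).  Every row of that list now has a general-kernel edition in the tree — the Schur tower and Gaussian re-indexing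
(`…CondKernelGeneric`), the conditioned field as a measure, (5.13) and the two-stage law (`…KernelCondField`), the regression
algebra (`…KernelRegression`), Lemma 2 of App. C (`…KernelAppendixCLemma2`), App. A (`…KernelAppendixA`), the displaced
pavement (`…KernelCondTranslation`), the class bounds (C.2)/(C.6)/(C.7)/(C.8) from a precision (`…KernelOfPrecision`) and the
(5.13) substitute (`…KernelComparison`) — EXCEPT ONE: Appendix D ii), *"𝓔^T_0(z^{A₁}, z^{A₂}, z^{A₃}; 1, 1, 1) is by definition
an algebraic sum of products of expectations values. As it is well known, once these expectations are expressed via the Wick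
theorem as sum of products of 2-point functions, the only terms that survive are the so called "connected diagrams" … the
exponential factors arising from i) and ii) give rise to an overall dumping factor"* (p. 166).  The tree holds it for the
conditioned FREE field only (`…AppendixDWick` §3–§4: `dmoment_eq_integral_prod`, `abs_ursellOf_condField_monomials_le_exp`,
typed on `condField d α β Γ z̄`), although both of its halves are kernel-generic already: the MEASURE half — Wick's theorem with
a source for the shifted field `(gaussianFieldOfKernel K).map (u + ·)` of ANY positive-semidefinite kernel on ANY index set —
is `…AppendixDWick.integral_prod_shift_eq_sum_setPartitions` (§2 there), and the COMBINATORIAL half — the exponential bound on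
the Ursell function of diagram moments with bounded sources and decaying propagators — is
`…AppendixDClustering.abs_ursellOf_dmoment_le_exp`.  This file composes them for a general kernel (§1) and specialises to the
conditioned field `P̄^K_{C,z̄} := (gaussianFieldOfKernel (condCov K C)).map (ζ ↦ condMean K C z̄ + ζ)` of a general kernel on
the lattice `Q₀` (§2, the `…KernelCondField` currency; positive semidefiniteness of `C^C` is
`…KernelRegression.isPosSemidefKernel_condCov`), with the covariance hypothesis also offered at SITE level (`…_of_dist`) — the
shape in which `…KernelOfPrecision.abs_condCov_kernel_le_exp` delivers (C.6) for the precision class, uniformly in the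
conditioning set.  These are the inputs the three Appendix-D cluster bounds of the §5 road (`…Sect5TupleClustersDecay`,
`…Sect5SlotMoments`, `…Sect5PolyClusters`) read the conditioned field through.

DICTIONARY.  `P̄(dz_□|z_{Γ₁})` ↦ `P̄^K_{C,z̄}` (§2) or a bare shifted kernel field `𝒩(0,K)∘(u + ·)⁻¹` (§1); a monomial cluster
`z^{A_j} = Π_{l : own l = j} z_{x_l}` ↦ legs `l : Λ` (`own : Λ → J`, positions `x : Λ → S`, `Λ` linearly ordered for the
pairing enumeration); «2-point functions» ↦ `K(x_a, x_b)` resp. `C^C(x_a, x_b) = condCov K C`; the mean insertions ↦ singleton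
blocks `u(x_l)` resp. `condMean K C z̄ (x_l)`; `𝓔^T(z^{A_j}, j ∈ J)` ↦ `LatticeModels.ursellOf (P ↦ ∫ Π_{l∈legs P} z(x_l)) (allV J)`.

WHAT IS PROVED (theorems only; no definition, no instance, no notation, no named fact, no `sorry`; axioms standard).
* §1 (any index type `S`, any psd kernel `K : S → S → ℝ`, any centre `u : S → ℝ`) ★ **`dmoment_eq_integral_prod_shift`** — the
  diagram moments `LegDiagram.dmoment own w ω P` with `w{l} = u(x_l)`, `w{a,b} = K(x_a,x_b)`, `w = 0` on larger blocks ARE the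
  moments `∫ Π_{l∈legs P} z(x_l) d[𝒩(0,K)∘(u+·)⁻¹]` on every vertex family without the observable;
  ★★ **`abs_ursellOf_shift_monomials_le_exp`** — APPENDIX D FOR THE SHIFTED KERNEL FIELD: `|u(x_l)| ≤ K₀`,
  `|K(x_a,x_b)| ≤ K₀e^{−δρ(a,b)}` for a pseudo-distance `ρ` on the legs ⟹ for ANY two legs `u₀, w₀`
  `|𝓔^T(z^{A_j}, j∈J)| ≤ 2^{|Λ|}·2^{2^{|Λ|}}·K₀^{|Λ|}·exp(−(δ/2)(ρ(u₀,w₀) − Σ_{same cluster}ρ))`;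
  **`abs_ursellOf_shift_monomials_le_exp_of_dist`** — the same from SITE-level hypotheses: a pseudo-distance `dist` on `S`
  (`dist y y = 0`, symmetric, triangle inequality — the hypothesis list of `…ClassAppendixC`/`…KernelOfPrecision`), sources
  bounded on the legs, `|K(y,y′)| ≤ K₀e^{−δ·dist(y,y′)}` for ALL sites, `ρ := dist` of the positions.
* §2 (the lattice `Q₀ = Site d`, `K` psd with `K_CC` invertible) **`integral_prod_eval_condFieldK_eq_sum_setPartitions`** — Wick's
  theorem with a source for `P̄^K_{C,z̄}` (sources `condMean K C z̄`, propagators `condCov K C`);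
  **`dmoment_eq_integral_prod_condFieldK`**; ★★ **`abs_ursellOf_condFieldK_monomials_le_exp`** — APPENDIX D FOR `P̄^K_{C,z̄}` from
  `|condMean K C z̄ (x_l)| ≤ K₀` and `|condCov K C (x_a) (x_b)| ≤ K₀e^{−δρ(a,b)}`; **`abs_ursellOf_condFieldK_monomials_le_exp_of_dist`**
  — the same with the covariance hypothesis at site level, `∀ y y′, |condCov K C y y′| ≤ K₀e^{−δ·dist(y,y′)}` (uniform in `C`:
  (C.6) for the class, `…KernelOfPrecision.abs_condCov_kernel_le_exp` with `K₀ := max 1 (1/(γ − J))`, `dist`, `δ := κ`).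
JUNCTION (said, not restated).  At `K = freeCov d α β` (`α, β > 0`) the expression `P̄^K_{C,z̄}` IS `condField d α β C z̄` by `rfl`
(`B1Eq324BenfattoLemma.condField`; recorded as `…Sect5SlotMoments.condField_eq_map`), `K_CC` is invertible by
`…AppendixC2.isUnit_det_covGram_freeCov`, and the tree's `…AppendixDWick.integral_prod_eval_condField_eq_sum_setPartitions` /
`dmoment_eq_integral_prod` / `abs_ursellOf_condField_monomials_le_exp` are the instances of §2 (checked by `exact` in the seat's
probe; they stay the free-field statements of record and are not touched).  NOT HERE: the primed free-field variant
`abs_ursellOf_condField_monomials_le_exp'` moves the propagator hypothesis to the FREE covariance through the positivity (C.6)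
`0 ≤ C^Γ ≤ C` — an M-matrix fact of the nearest-neighbour field with no analogue for a signed kernel (census §3.3, «H6»); for
the class the conditioned decay enters directly (F4), which is what `…_of_dist` displays.

HONEST SCOPE.  Kernel-generic Wick/Ursell combinatorics and a Gaussian push-forward — [folklore] mathematics at [BenfattoEtAl1978]'s
locus; the diagram count `2^{|Λ|}·2^{2^{|Λ|}}` is r14's crude `card_diags_le`, not print's `s₅`; the corridor geometry of p. 166
(choice of `u₀ ∈ □′∖Γ₄(□)`, `w₀ ∈ Γ₂(□)`) is the boxes line's, here `ρ`, `K₀`, `δ` are hypotheses.  The class HYPOTHESES of a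
generalised Basic Lemma and that lemma are NOT stated or proved here; nothing of the §5 chain is ported; nothing of
[Balaban1985UV3] (24)/(41)/(47)/(58) or [Balaban1985UV2] is asserted; count-neutral for N08; nothing about d = 4, the continuum,
OS axioms, a mass gap or the Clay problem.
-/

open Finset MeasureTheory
open scoped BigOperators

namespace Literature.MathematicalPhysics.QuantumFieldTheory.Balaban1983to89.B1Eq324BenfattoKernelAppendixD

open _root_.MeasureTheory _root_.ProbabilityTheory
open Literature.Probability.LatticeModels (setPartitions IsSetPartition mem_setPartitions ursellOf ursellOf_eq)
open Literature.Probability.LatticeModels.LegDiagram (legs mem_legs diags mem_diags IsDiag IsConn dval dmoment sum_diags)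
open Literature.MathematicalPhysics.QuantumFieldTheory
open Literature.MathematicalPhysics.QuantumFieldTheory.Balaban1983to89.HiggsFluctMeasureWickPairings
  (pairVal pairVal_pair pairVal_of_card_ne_two)
open Literature.MathematicalPhysics.QuantumFieldTheory.Balaban1983to89.B1Eq323ConnectedGraphBound
  (allV some_mem_allV none_not_mem_allV)
open Literature.MathematicalPhysics.QuantumFieldTheory.Balaban1983to89.B1Eq324BenfattoAppendixDClustering
  (abs_ursellOf_dmoment_le_exp)
open Literature.MathematicalPhysics.QuantumFieldTheory.Balaban1983to89.B1Eq324BenfattoAppendixDWick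
  (integral_prod_shift_eq_sum_setPartitions)
open Literature.MathematicalPhysics.QuantumFieldTheory.Balaban1983to89.B1Eq324BenfattoLemma
open Literature.MathematicalPhysics.QuantumFieldTheory.Balaban1983to89.B1Eq324BenfattoKernelRegression
  (isPosSemidefKernel_condCov)

/-! ## §1  Appendix D ii) for a shifted Gaussian kernel field on any index set -/

section Shift

variable {S : Type} [DecidableEq S] {K : S → S → ℝ}
variable {J : Type} [Fintype J] [DecidableEq J] {Λ : Type} [Fintype Λ] [LinearOrder Λ] (own : Λ → J)

/-- Locality of the Ursell function: it reads the moment function on the subsets of `V` only (private copy, as in the sibling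
files). [folklore] -/
private theorem ursellOf_congr {γ : Type*} [DecidableEq γ] {m m' : Finset γ → ℝ} {V : Finset γ}
    (h : ∀ P ⊆ V, m P = m' P) : ursellOf m V = ursellOf m' V := by
  induction V using Finset.strongInduction with
  | H V ih =>
    rw [ursellOf_eq, ursellOf_eq, h V Subset.rfl]
    congr 1
    refine sum_congr rfl fun π hπ => prod_congr rfl fun P hP => ?_
    obtain ⟨hne, hπ'⟩ := mem_erase.1 hπ
    have hsp := mem_setPartitions.1 hπ'
    have hPV : P ⊂ V := hsp.ssubset_of_ne_singleton hne hP
    exact ih P hPV fun Q hQ => h Q (hQ.trans hPV.subset)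

omit [Fintype J] in
/-- **THE MOMENTS OF THE CLUSTERS ARE DIAGRAM MOMENTS, FOR ANY SHIFTED KERNEL FIELD**: for a positive-semidefinite kernel `K` on any
index set `S`, a centre `u : S → ℝ`, leg positions `x : Λ → S` and a vertex family `P` without the observable, p13's
`LegDiagram.dmoment own w ω P` with the source/propagator block weights `w{l} = u(x_l)`, `w{a,b} = K(x_a,x_b)`, `w(B) = 0` for
`|B| ≥ 3` (any observable weight `ω`: it is never read) IS the joint moment `∫ Π_{l ∈ legs P} z(x_l) d[𝒩(0,K)∘(u+·)⁻¹]` — Wick's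
theorem with a source (`…AppendixDWick.integral_prod_shift_eq_sum_setPartitions`) read in the diagram vocabulary.  The tree's
`…AppendixDWick.dmoment_eq_integral_prod` is the instance `K = condCov (freeCov d α β) Γ`, `u = condMean (freeCov d α β) Γ z̄`.
[cite: BenfattoEtAl1978, Appendix D p.166] -/
theorem dmoment_eq_integral_prod_shift (hK : IsPosSemidefKernel K) (u : S → ℝ) (x : Λ → S) (ω : Finset Λ → ℝ)
    {P : Finset (Option J)} (hP : none ∉ P) :
    dmoment own (fun B => if B.card = 1 then ∏ l ∈ B, u (x l) else pairVal (fun i j => K (x i) (x j)) B) ω P =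
      ∫ z, ∏ l ∈ legs own P, z (x l) ∂((gaussianFieldOfKernel K).map fun (ζ : S → ℝ) (y : S) => u y + ζ y) := by
  rw [integral_prod_shift_eq_sum_setPartitions hK u (legs own P) x, dmoment, sum_diags]
  have hD : (legs own P).powerset.filter (fun D => D.Nonempty → none ∈ P) = {∅} := by
    ext D
    simp only [mem_filter, mem_powerset, mem_singleton]
    constructor
    · rintro ⟨-, h⟩
      by_contra hne
      exact hP (h (nonempty_iff_ne_empty.2 hne))
    · rintro rfl
      exact ⟨empty_subset _, fun h => absurd h (by simp)⟩
  rw [hD, sum_singleton, sdiff_empty]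
  refine sum_congr rfl fun τ _ => ?_
  rw [dval, if_neg hP, mul_one]

/-- **APPENDIX D FOR A SHIFTED GAUSSIAN KERNEL FIELD** — «the only terms that survive are the so called "connected diagrams" … an
overall dumping factor»: let the legs `Λ` of the monomial clusters `own : Λ → J` (all clusters present) sit at positions
`x : Λ → S`, let `K` be a positive-semidefinite kernel on `S` and `u` a centre, and let `ρ` be a pseudo-distance on the legs with
`|u(x_l)| ≤ K₀` and `|K(x_a,x_b)| ≤ K₀e^{−δρ(a,b)}` (`K₀ ≥ 1`, `δ ≥ 0`).  Then the joint truncated expectation of the clusters under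
the shifted field `𝒩(0,K)∘(u+·)⁻¹` satisfies, for ANY two legs `u₀, w₀`,
`|𝓔^T(z^{A_j}, j ∈ J)| ≤ 2^{|Λ|}·2^{2^{|Λ|}}·K₀^{|Λ|}·exp(−(δ/2)(ρ(u₀,w₀) − Σ_{same cluster}ρ))`
(`dmoment_eq_integral_prod_shift` + `…AppendixDClustering.abs_ursellOf_dmoment_le_exp`).  The tree's
`…AppendixDWick.abs_ursellOf_condField_monomials_le_exp` is the conditioned-free-field instance.
[cite: BenfattoEtAl1978, Appendix D p.166] -/
theorem abs_ursellOf_shift_monomials_le_exp [Nonempty J] (hK : IsPosSemidefKernel K) (u : S → ℝ) (x : Λ → S)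
    (ρ : Λ → Λ → ℝ) {K₀ δ : ℝ}
    (h0 : ∀ a, ρ a a = 0) (hsymm : ∀ a b, ρ a b = ρ b a) (htri : ∀ a b c, ρ a c ≤ ρ a b + ρ b c)
    (hnn : ∀ a b, 0 ≤ ρ a b) (hK₀ : 1 ≤ K₀) (hδ : 0 ≤ δ)
    (hu : ∀ l, |u (x l)| ≤ K₀) (hC : ∀ a b, |K (x a) (x b)| ≤ K₀ * Real.exp (-(δ * ρ a b))) (u₀ w₀ : Λ) :
    |ursellOf (fun P : Finset (Option J) =>
        ∫ z, ∏ l ∈ legs own P, z (x l) ∂((gaussianFieldOfKernel K).map fun (ζ : S → ℝ) (y : S) => u y + ζ y)) (allV J)| ≤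
      2 ^ Fintype.card Λ * 2 ^ 2 ^ Fintype.card Λ * (K₀ ^ Fintype.card Λ *
        Real.exp (-(δ / 2 * (ρ u₀ w₀ - ∑ p ∈ univ.filter (fun p : Λ × Λ => own p.1 = own p.2), ρ p.1 p.2)))) := by
  set w : Finset Λ → ℝ := fun B => if B.card = 1 then ∏ l ∈ B, u (x l) else pairVal (fun i j => K (x i) (x j)) B
    with hw
  have hloc : ursellOf (fun P : Finset (Option J) =>
        ∫ z, ∏ l ∈ legs own P, z (x l) ∂((gaussianFieldOfKernel K).map fun (ζ : S → ℝ) (y : S) => u y + ζ y)) (allV J)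
      = ursellOf (dmoment own w (fun _ => 0)) (allV J) := by
    refine ursellOf_congr fun P hP => ?_
    rw [dmoment_eq_integral_prod_shift own hK u x (fun _ => 0) fun h => none_not_mem_allV (hP h)]
  rw [hloc]
  refine abs_ursellOf_dmoment_le_exp own ρ w (fun _ => 0) h0 hsymm htri hnn hK₀ hδ ?_ ?_ ?_ u₀ w₀
  · intro l
    simp only [hw, card_singleton, if_true, prod_singleton]
    exact hu l
  · intro a b hab
    simp only [hw, card_pair hab]
    rw [if_neg (by omega)]
    rcases lt_or_gt_of_ne hab with h | h
    · rw [pairVal_pair _ h]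
      exact hC a b
    · rw [pair_comm, pairVal_pair _ h, hsymm a b]
      exact hC b a
  · intro B hB
    simp only [hw]
    rw [if_neg (by omega), pairVal_of_card_ne_two _ (by omega)]

/-- **APPENDIX D FOR A SHIFTED KERNEL FIELD, SITE-LEVEL HYPOTHESES**: with a pseudo-distance `dist` on the index set `S` (zero
diagonal, symmetric, triangle inequality — the hypothesis list of the precision class, `…ClassAppendixC` / `…KernelOfPrecision`),
sources bounded on the legs `|u(x_l)| ≤ K₀` and the kernel decaying at site level `|K(y,y′)| ≤ K₀e^{−δ·dist(y,y′)}` for ALL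
`y, y′` (e.g. (C.2)/(C.6) for the class), the bound of `abs_ursellOf_shift_monomials_le_exp` holds with `ρ(a,b) := dist(x_a,x_b)`:
`|𝓔^T(z^{A_j}, j ∈ J)| ≤ 2^{|Λ|}·2^{2^{|Λ|}}·K₀^{|Λ|}·exp(−(δ/2)(dist(x_{u₀},x_{w₀}) − Σ_{same cluster}dist))`.
[cite: BenfattoEtAl1978, Appendix D p.166 and Appendix C (C.2), (C.6) p.164] -/
theorem abs_ursellOf_shift_monomials_le_exp_of_dist [Nonempty J] (hK : IsPosSemidefKernel K) (u : S → ℝ) (x : Λ → S)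
    (dist : S → S → ℝ) {K₀ δ : ℝ}
    (hd0 : ∀ y, dist y y = 0) (hdsymm : ∀ y y', dist y y' = dist y' y)
    (hdtri : ∀ y y' y'', dist y y'' ≤ dist y y' + dist y' y'') (hK₀ : 1 ≤ K₀) (hδ : 0 ≤ δ)
    (hu : ∀ l, |u (x l)| ≤ K₀) (hC : ∀ y y', |K y y'| ≤ K₀ * Real.exp (-(δ * dist y y'))) (u₀ w₀ : Λ) :
    |ursellOf (fun P : Finset (Option J) =>
        ∫ z, ∏ l ∈ legs own P, z (x l) ∂((gaussianFieldOfKernel K).map fun (ζ : S → ℝ) (y : S) => u y + ζ y)) (allV J)| ≤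
      2 ^ Fintype.card Λ * 2 ^ 2 ^ Fintype.card Λ * (K₀ ^ Fintype.card Λ *
        Real.exp (-(δ / 2 * (dist (x u₀) (x w₀) -
          ∑ p ∈ univ.filter (fun p : Λ × Λ => own p.1 = own p.2), dist (x p.1) (x p.2))))) := by
  have hdnn : ∀ y y', 0 ≤ dist y y' := fun y y' => by
    have h := hdtri y y' y
    rw [hd0 y, hdsymm y' y] at h
    linarith
  exact abs_ursellOf_shift_monomials_le_exp own hK u x (fun a b => dist (x a) (x b)) (fun a => hd0 (x a))
    (fun a b => hdsymm (x a) (x b)) (fun a b c => hdtri (x a) (x b) (x c)) (fun a b => hdnn (x a) (x b)) hK₀ hδ hu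
    (fun a b => hC (x a) (x b)) u₀ w₀

end Shift

/-! ## §2  Appendix D ii) for the conditioned field `P̄^K_{C,z̄}` of a general kernel on the lattice -/

section CondFieldK

variable {d : ℕ} {K : B1Eq324BenfattoLemma.Site d → B1Eq324BenfattoLemma.Site d → ℝ} (hKp : IsPosSemidefKernel K)
  (C : Finset (B1Eq324BenfattoLemma.Site d)) (hC : IsUnit (covGram K C).det)

section Wick

variable {κ : Type*} [LinearOrder κ]

include hKp hC

/-- **THE MOMENTS OF MONOMIALS UNDER `P̄^K_{C,z̄}`** (centre `u_C(z̄) = condMean K C z̄`, covariance `C^C = condCov K C` — p. 164 «a non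
centered gaussian field with covariance C^Γ_{ΔΔ′} … and center u_Δ», for the class): for legs `x : κ → Q₀`,
`∫ Π_{l∈s} z(x_l) dP̄^K_{C,z̄} = Σ_{τ∈𝒫(s)} Π_{B∈τ} w(B)` with `w{l} = u_C(z̄)(x_l)`, `w{a,b} = C^C(x_a,x_b)`, `0` on larger blocks
(`…AppendixDWick.integral_prod_shift_eq_sum_setPartitions` at the psd kernel `C^C`, `…KernelRegression.isPosSemidefKernel_condCov`).
The tree's `…AppendixDWick.integral_prod_eval_condField_eq_sum_setPartitions` is the instance `K = freeCov d α β`.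
[cite: BenfattoEtAl1978, Appendix D p.166 and Appendix C 2) p.164] -/
theorem integral_prod_eval_condFieldK_eq_sum_setPartitions (zbar : B1Eq324BenfattoLemma.Site d → ℝ) (s : Finset κ)
    (x : κ → B1Eq324BenfattoLemma.Site d) :
    ∫ z, ∏ l ∈ s, z (x l) ∂((gaussianFieldOfKernel (condCov K C)).map
        fun (ζ : B1Eq324BenfattoLemma.Site d → ℝ) (y : B1Eq324BenfattoLemma.Site d) => condMean K C zbar y + ζ y) =
      ∑ τ ∈ setPartitions s, ∏ B ∈ τ,
        (if B.card = 1 then ∏ l ∈ B, condMean K C zbar (x l)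
          else pairVal (fun i j => condCov K C (x i) (x j)) B) :=
  integral_prod_shift_eq_sum_setPartitions (isPosSemidefKernel_condCov K hKp C hC) _ s x

end Wick

variable {J : Type} [Fintype J] [DecidableEq J] {Λ : Type} [Fintype Λ] [LinearOrder Λ] (own : Λ → J)

include hKp hC

omit [Fintype J] in
/-- **THE MOMENTS OF THE CLUSTERS UNDER `P̄^K_{C,z̄}` ARE DIAGRAM MOMENTS**: for a vertex family `P` without the observable,
`LegDiagram.dmoment own w ω P` with `w{l} = condMean K C z̄ (x_l)`, `w{a,b} = condCov K C (x_a) (x_b)`, `0` on larger blocks IS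
`∫ Π_{l ∈ legs P} z(x_l) dP̄^K_{C,z̄}` (`dmoment_eq_integral_prod_shift` at `C^C`).  The tree's `…AppendixDWick.dmoment_eq_integral_prod`
is the instance `K = freeCov d α β`. [cite: BenfattoEtAl1978, Appendix D p.166] -/
theorem dmoment_eq_integral_prod_condFieldK (zbar : B1Eq324BenfattoLemma.Site d → ℝ)
    (x : Λ → B1Eq324BenfattoLemma.Site d) (ω : Finset Λ → ℝ) {P : Finset (Option J)} (hP : none ∉ P) :
    dmoment own (fun B => if B.card = 1 then ∏ l ∈ B, condMean K C zbar (x l)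
        else pairVal (fun i j => condCov K C (x i) (x j)) B) ω P =
      ∫ z, ∏ l ∈ legs own P, z (x l) ∂((gaussianFieldOfKernel (condCov K C)).map
        fun (ζ : B1Eq324BenfattoLemma.Site d → ℝ) (y : B1Eq324BenfattoLemma.Site d) => condMean K C zbar y + ζ y) :=
  dmoment_eq_integral_prod_shift own (isPosSemidefKernel_condCov K hKp C hC) _ x ω hP

/-- **APPENDIX D FOR THE CONDITIONED FIELD OF A GENERAL KERNEL**: let the legs `Λ` of the monomial clusters `own : Λ → J` (all
clusters present) sit at tesserae `x : Λ → Q₀`, let `K` be a positive-semidefinite kernel on `Q₀` with `K_CC` invertible, and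
let `ρ` be a pseudo-distance on the legs such that the conditioned centre and covariance obey `|condMean K C z̄ (x_l)| ≤ K₀`,
`|condCov K C (x_a) (x_b)| ≤ K₀e^{−δρ(a,b)}` (`K₀ ≥ 1`, `δ ≥ 0`; for the precision class: (C.8) `…KernelOfPrecision.abs_condMean_kernel_le_profile`
on the box and (C.6) `abs_condCov_kernel_le_exp`).  Then for ANY two legs `u₀, w₀`
`|𝓔^T_{z̄}(z^{A_j}, j ∈ J)| ≤ 2^{|Λ|}·2^{2^{|Λ|}}·K₀^{|Λ|}·exp(−(δ/2)(ρ(u₀,w₀) − Σ_{same cluster}ρ))` under `P̄^K_{C,z̄}`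
(`abs_ursellOf_shift_monomials_le_exp` at `C^C`).  The tree's `…AppendixDWick.abs_ursellOf_condField_monomials_le_exp` is the
instance `K = freeCov d α β`. [cite: BenfattoEtAl1978, Appendix D p.166] -/
theorem abs_ursellOf_condFieldK_monomials_le_exp [Nonempty J] (zbar : B1Eq324BenfattoLemma.Site d → ℝ)
    (x : Λ → B1Eq324BenfattoLemma.Site d) (ρ : Λ → Λ → ℝ) {K₀ δ : ℝ}
    (h0 : ∀ a, ρ a a = 0) (hsymm : ∀ a b, ρ a b = ρ b a) (htri : ∀ a b c, ρ a c ≤ ρ a b + ρ b c)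
    (hnn : ∀ a b, 0 ≤ ρ a b) (hK₀ : 1 ≤ K₀) (hδ : 0 ≤ δ)
    (hu : ∀ l, |condMean K C zbar (x l)| ≤ K₀)
    (hCd : ∀ a b, |condCov K C (x a) (x b)| ≤ K₀ * Real.exp (-(δ * ρ a b))) (u₀ w₀ : Λ) :
    |ursellOf (fun P : Finset (Option J) => ∫ z, ∏ l ∈ legs own P, z (x l)
        ∂((gaussianFieldOfKernel (condCov K C)).map
          fun (ζ : B1Eq324BenfattoLemma.Site d → ℝ) (y : B1Eq324BenfattoLemma.Site d) => condMean K C zbar y + ζ y))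
        (allV J)| ≤
      2 ^ Fintype.card Λ * 2 ^ 2 ^ Fintype.card Λ * (K₀ ^ Fintype.card Λ *
        Real.exp (-(δ / 2 * (ρ u₀ w₀ - ∑ p ∈ univ.filter (fun p : Λ × Λ => own p.1 = own p.2), ρ p.1 p.2)))) :=
  abs_ursellOf_shift_monomials_le_exp own (isPosSemidefKernel_condCov K hKp C hC) _ x ρ h0 hsymm htri hnn hK₀ hδ hu hCd
    u₀ w₀

/-- **APPENDIX D FOR `P̄^K_{C,z̄}`, SITE-LEVEL COVARIANCE HYPOTHESIS**: with a pseudo-distance `dist` on `Q₀` (zero diagonal,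
symmetric, triangle inequality), `|condMean K C z̄ (x_l)| ≤ K₀` on the legs and the conditioned covariance decaying at site level
`|condCov K C y y′| ≤ K₀e^{−δ·dist(y,y′)}` for ALL `y, y′` — (C.6) for the class UNIFORMLY IN THE CONDITIONING SET, the output of
`…KernelOfPrecision.abs_condCov_kernel_le_exp` with `K₀ := max 1 (1/(γ − J))`, `δ := κ` — the bound holds with
`ρ(a,b) := dist(x_a,x_b)`. [cite: BenfattoEtAl1978, Appendix D p.166 and Appendix C (C.6) p.164] -/
theorem abs_ursellOf_condFieldK_monomials_le_exp_of_dist [Nonempty J] (zbar : B1Eq324BenfattoLemma.Site d → ℝ)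
    (x : Λ → B1Eq324BenfattoLemma.Site d) (dist : B1Eq324BenfattoLemma.Site d → B1Eq324BenfattoLemma.Site d → ℝ)
    {K₀ δ : ℝ} (hd0 : ∀ y, dist y y = 0) (hdsymm : ∀ y y', dist y y' = dist y' y)
    (hdtri : ∀ y y' y'', dist y y'' ≤ dist y y' + dist y' y'') (hK₀ : 1 ≤ K₀) (hδ : 0 ≤ δ)
    (hu : ∀ l, |condMean K C zbar (x l)| ≤ K₀)
    (hCd : ∀ y y', |condCov K C y y'| ≤ K₀ * Real.exp (-(δ * dist y y'))) (u₀ w₀ : Λ) :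
    |ursellOf (fun P : Finset (Option J) => ∫ z, ∏ l ∈ legs own P, z (x l)
        ∂((gaussianFieldOfKernel (condCov K C)).map
          fun (ζ : B1Eq324BenfattoLemma.Site d → ℝ) (y : B1Eq324BenfattoLemma.Site d) => condMean K C zbar y + ζ y))
        (allV J)| ≤
      2 ^ Fintype.card Λ * 2 ^ 2 ^ Fintype.card Λ * (K₀ ^ Fintype.card Λ *
        Real.exp (-(δ / 2 * (dist (x u₀) (x w₀) -
          ∑ p ∈ univ.filter (fun p : Λ × Λ => own p.1 = own p.2), dist (x p.1) (x p.2))))) :=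
  abs_ursellOf_shift_monomials_le_exp_of_dist own (isPosSemidefKernel_condCov K hKp C hC) _ x dist hd0 hdsymm hdtri hK₀ hδ
    hu hCd u₀ w₀

end CondFieldK

end Literature.MathematicalPhysics.QuantumFieldTheory.Balaban1983to89.B1Eq324BenfattoKernelAppendixD
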